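import Mathlib
import Literature.NumberTheory.Transcendental.LindemannWeierstrassProofs
import Summits.KontsevichZagierPeriods.KontsevichZagierPeriods.Theorems.InverseLandauTateLiftingDimZeroRing
import Summits.KontsevichZagierPeriods.KontsevichZagierPeriods.Theorems.InverseLandauTateLiftingAlgIndepSaturation
import Summits.KontsevichZagierPeriods.KontsevichZagierPeriods.Theorems.GrothendieckSectorComplementStubRingJoinKPi
import Summits.KontsevichZagierPeriods.KontsevichZagierPeriods.Theorems.CobordismMoveCP2VolumeCharts
import Summits.KontsevichZagierPeriods.KontsevichZagierPeriods.Theorems.CompiledSubstitutionsPiNormalisation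

/-!
# `TateLifting` (stmt-KontsevichZagierPeriods-9129), line `Sketch` — the transcendence sector over `ℚ̄`

Crux `Summit.KontsevichZagierPeriods.KontsevichZagierPeriods.Theses.InverseLandau.TateLifting`
(`ker KZ.eval ⊆ KZ.relations ⊔ closure T`, `T` = Tate fibres) is Conjecture-1-strength in general; the
line lands the SECTORS on which it is a theorem. Leads c2–c4 organised sectors by dimension and
presentation (the Baker module); lead c5 opened the axis of TRANSCENDENCE DEGREE and this file (lead c6,
wave c6-1) assembles it from the five landed stubs 29–33.

In the formal period ring `P = KZ.FormalPeriodRing = FormalRep ⧸ relations` (`KZ.evalP : P →+* ℝ`) the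
kernel form of Conjecture 1 on a sector is injectivity of `evalP` on a subring. Write `K₀ ≤ P` for the
subring generated by the classes `⟦[b]⟧` of all representations over `ℝ⁰` — by `tateLifting_dimZeroRing`
(stub 29) it consists of the point classes `⟦[pt, a]⟧`, `a` real algebraic, and `evalP` maps it
injectively onto the real algebraic numbers. The transfer `tateLifting_algIndepSaturation` (stub 30)
then gives (§1): for EVERY family of classes `x i` whose values are algebraically independent over `ℚ`,
`evalP` is injective on `K₀[x_i]` (`transcRingKernel`), and — joined with the saturation lemma of the
Grothendieck route (`stub_saturationKernel`: generators with a non-zero integer multiple already in the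
ring are free) — on `K₀[x_i, T]` for any such set `T` of torsion generators (`transcRingKernel_sat`);
at the level of formal combinations this is the kernel form of Conjecture 1 with ALGEBRAIC coefficients
(`transcKernel`, `transc_sub_mem_relations`) and a sector of the crux (`TateLifting_transcSector`).

§2 instantiates with the transcendence theorems PROVED in the tree: Lindemann (`transcendental_pi_holds`)
and Chudnovsky in the two forms `kPiAlgIndependent`, `ePiAlgIndependent` (`K(1/√2), π` and `E(1/√2), π`
algebraically independent), with the MZV word classes of weights `2`, `4` as torsion generators
(`exists_nsmul_mem_of_wordClass`): `evalP` is injective on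
`ℚ̄[π, ζ(2), ζ(4), ζ(3,1), ζ(2,2), ζ(2,1,1)]`, on `ℚ̄[K(1/√2), π, ζ(2), …, ζ(2,1,1)]` and on
`ℚ̄[E(1/√2), π, ζ(2), …, ζ(2,1,1)]` (classes understood) — every polynomial identity with REAL-ALGEBRAIC
coefficients among these numbers is derivable by the three rules of Kontsevich–Zagier, unconditionally
(`piSectorRingKernel`, `kPiSectorRingKernel`, `ePiSectorRingKernel`; the Grothendieck route had the
`ℤ`-coefficient rings), plus the free pair `ℚ̄[K(1/√2), E(1/√2)]` (`kESectorRingKernel`). The companion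
file `Theorems/InverseLandauTateLiftingTranscSectorEntries.lean` records how representations ENTER these
rings through the moves landed in the wave (`[(0,1), 4dx/(1+x²)]` has the class of the disc — stub 32;
Fubini products have the product class — stub 31; the square substitution preserves the class — stub 33),
the two-representation forms, and the Beta-value instances (`B(1/3,1/3)`, stubs 34 ff.).

References: M. Kontsevich, D. Zagier, *Periods* (2001), §1.1 eq. (1), §1.2 (Conjecture 1, rules
(1)–(3)), §4.1; F. Lindemann (1882); G. V. Chudnovsky, *Contributions to the theory of transcendental
numbers* (1984), Ch. 7.
-/

noncomputable section

open MeasureTheory Set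
open Literature.NumberTheory.Transcendental
open Literature.Analysis.SpecialFunctions (lemniscaticK lemniscaticE)
open Summit.KontsevichZagierPeriods.Grothendieck.GpcLegendreLemniscaticNegative (kRep eRep kRep_value
  eRep_value)
open Summit.KontsevichZagierPeriods.MzvKernelInKZ.Negative (genSetAdm)
open Summit.KontsevichZagierPeriods.Grothendieck.SectorComplementRingJoin (stub_saturationKernel
  exists_nsmul_mem_of_wordClass kPiAlgIndependent ePiAlgIndependent)

namespace Summit.KontsevichZagierPeriods.InverseLandau

/-! ## §1 The transfer: algebraic independence of values ⇒ Conjecture 1 on `K₀[x]` -/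

/-- **`evalP` is injective on `K₀[x]`** for every family `x` of formal periods with algebraically
independent values: `K₀` (the ring of dimension-zero classes) has algebraic values and `evalP` is
injective on it (`tateLifting_dimZeroRing`), so the saturation transfer `tateLifting_algIndepSaturation`
applies with `R₀ = K₀`. [cite: KontsevichZagier2001, §1.2] -/
theorem transcRingKernel {ι : Type} (x : ι → KZ.FormalPeriodRing)
    (hx : AlgebraicIndependent ℚ fun i => KZ.evalP (x i)) :
    ∀ y ∈ Subring.closure
        (Set.range (fun b : KZ.IntegralRep 0 => KZ.toFormalPeriod (KZ.of b)) ∪ Set.range x),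
      KZ.evalP y = 0 → y = 0 := by
  intro y hy hy0
  set R₀ : Subring KZ.FormalPeriodRing :=
    Subring.closure (Set.range fun b : KZ.IntegralRep 0 => KZ.toFormalPeriod (KZ.of b)) with hR₀
  have halg : ∀ a ∈ R₀, IsAlgebraic ℚ (KZ.evalP a) := fun a ha => (tateLifting_dimZeroRing a ha).2.1
  have hinj : ∀ a ∈ R₀, KZ.evalP a = 0 → a = 0 := fun a ha => (tateLifting_dimZeroRing a ha).2.2
  refine tateLifting_algIndepSaturation ι x R₀ halg hinj hx y (Subring.closure_mono ?_ hy) hy0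
  exact Set.union_subset_union_left _ Subring.subset_closure

/-- **`evalP` is injective on `K₀[x, T]`** when moreover every `t ∈ T` has a non-zero integer multiple
in `K₀[x]` (containment joins are free: `stub_saturationKernel` of the Grothendieck route, torsion-freeness
of `P`). [cite: KontsevichZagier2001, §1.2] -/
theorem transcRingKernel_sat {ι : Type} (x : ι → KZ.FormalPeriodRing)
    (hx : AlgebraicIndependent ℚ fun i => KZ.evalP (x i)) (T : Set KZ.FormalPeriodRing)
    (hT : ∀ t ∈ T, ∃ n : ℕ, n ≠ 0 ∧ n • t ∈ Subring.closure
        (Set.range (fun b : KZ.IntegralRep 0 => KZ.toFormalPeriod (KZ.of b)) ∪ Set.range x)) :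
    ∀ y ∈ Subring.closure
        (Set.range (fun b : KZ.IntegralRep 0 => KZ.toFormalPeriod (KZ.of b)) ∪ Set.range x ∪ T),
      KZ.evalP y = 0 → y = 0 := by
  intro y hy hy0
  set R₁ : Subring KZ.FormalPeriodRing := Subring.closure
    (Set.range (fun b : KZ.IntegralRep 0 => KZ.toFormalPeriod (KZ.of b)) ∪ Set.range x) with hR₁
  refine stub_saturationKernel R₁ T (transcRingKernel x hx) hT y (Subring.closure_mono ?_ hy) hy0
  exact Set.union_subset_union_left _ Subring.subset_closure

/-- **Conjecture 1 (kernel form) with algebraic coefficients on a transcendence sector**: a formal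
`ℤ`-combination of integral representations whose class lies in `K₀[x, T]` (`x` with algebraically
independent values, `T` torsion generators over `K₀[x]`) and whose value vanishes is a relation of the
Kontsevich–Zagier calculus. [cite: KontsevichZagier2001, §1.2] -/
theorem transcKernel {ι : Type} (x : ι → KZ.FormalPeriodRing)
    (hx : AlgebraicIndependent ℚ fun i => KZ.evalP (x i)) (T : Set KZ.FormalPeriodRing)
    (hT : ∀ t ∈ T, ∃ n : ℕ, n ≠ 0 ∧ n • t ∈ Subring.closure
        (Set.range (fun b : KZ.IntegralRep 0 => KZ.toFormalPeriod (KZ.of b)) ∪ Set.range x))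
    (c : KZ.FormalRep)
    (hc : KZ.toFormalPeriod c ∈ Subring.closure
        (Set.range (fun b : KZ.IntegralRep 0 => KZ.toFormalPeriod (KZ.of b)) ∪ Set.range x ∪ T))
    (h0 : KZ.eval c = 0) : c ∈ KZ.relations :=
  KZ.toFormalPeriod_eq_zero_iff.1
    (transcRingKernel_sat x hx T hT _ hc (by rw [KZ.evalP_toFormalPeriod, h0]))

/-- **Equal values ⇒ difference is a relation** on a transcendence sector. [cite: KontsevichZagier2001, §1.2] -/
theorem transc_sub_mem_relations {ι : Type} (x : ι → KZ.FormalPeriodRing)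
    (hx : AlgebraicIndependent ℚ fun i => KZ.evalP (x i)) (T : Set KZ.FormalPeriodRing)
    (hT : ∀ t ∈ T, ∃ n : ℕ, n ≠ 0 ∧ n • t ∈ Subring.closure
        (Set.range (fun b : KZ.IntegralRep 0 => KZ.toFormalPeriod (KZ.of b)) ∪ Set.range x))
    (c d : KZ.FormalRep)
    (hc : KZ.toFormalPeriod c ∈ Subring.closure
        (Set.range (fun b : KZ.IntegralRep 0 => KZ.toFormalPeriod (KZ.of b)) ∪ Set.range x ∪ T))
    (hd : KZ.toFormalPeriod d ∈ Subring.closure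
        (Set.range (fun b : KZ.IntegralRep 0 => KZ.toFormalPeriod (KZ.of b)) ∪ Set.range x ∪ T))
    (hval : KZ.eval c = KZ.eval d) : c - d ∈ KZ.relations :=
  transcKernel x hx T hT (c - d) (by rw [map_sub]; exact Subring.sub_mem _ hc hd)
    (by rw [map_sub, hval, sub_self])

/-- **The crux on the transcendence sector**: every such vanishing combination lies in
`KZ.relations ⊔ closure T` for the Tate set `T` of `TateLifting` (indeed in `KZ.relations`).
[cite: KontsevichZagier2001, §1.2] -/
theorem TateLifting_transcSector {ι : Type} (x : ι → KZ.FormalPeriodRing)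
    (hx : AlgebraicIndependent ℚ fun i => KZ.evalP (x i)) (T : Set KZ.FormalPeriodRing)
    (hT : ∀ t ∈ T, ∃ n : ℕ, n ≠ 0 ∧ n • t ∈ Subring.closure
        (Set.range (fun b : KZ.IntegralRep 0 => KZ.toFormalPeriod (KZ.of b)) ∪ Set.range x)) :
    ∀ c : KZ.FormalRep, KZ.toFormalPeriod c ∈ Subring.closure
        (Set.range (fun b : KZ.IntegralRep 0 => KZ.toFormalPeriod (KZ.of b)) ∪ Set.range x ∪ T) →
      KZ.eval c = 0 → c ∈ KZ.relations ⊔ AddSubgroup.closure {d : KZ.FormalRep |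
        ∃ (n : ℕ) (P Q : MvPolynomial (Fin (n + 1)) ℚ) (ε ϖ₀ : ℝ) (r : KZ.IntegralRep n), 0 < ε ∧
        (∃ c₀ : ℚ, c₀ ≠ 0 ∧ ∀ z : Fin n → ℝ,
          MvPolynomial.aeval (Fin.snoc z (0 : ℝ) : Fin (n + 1) → ℝ) Q = (c₀ : ℝ)) ∧
        (∀ (z : Fin n → ℝ) (ϖ : ℝ), (∀ i, z i ∈ Set.Icc (0 : ℝ) 1) → ϖ ∈ Set.Ioo 0 ε →
          MvPolynomial.aeval (Fin.snoc z ϖ : Fin (n + 1) → ℝ) Q ≠ 0) ∧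
        (∀ ϖ ∈ Set.Ioo (0 : ℝ) ε, ∫ z in Set.pi Set.univ (fun _ : Fin n => Set.Ioo (0 : ℝ) 1),
          MvPolynomial.aeval (Fin.snoc z ϖ : Fin (n + 1) → ℝ) P /
            MvPolynomial.aeval (Fin.snoc z ϖ : Fin (n + 1) → ℝ) Q = 0) ∧
        IsAlgebraic ℚ ϖ₀ ∧ ϖ₀ ∈ Set.Ioo 0 ε ∧
        r.domain = Set.pi Set.univ (fun _ : Fin n => Set.Ioo (0 : ℝ) 1) ∧
        Set.EqOn r.integrand (fun z => MvPolynomial.aeval (Fin.snoc z ϖ₀ : Fin (n + 1) → ℝ) P /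
          MvPolynomial.aeval (Fin.snoc z ϖ₀ : Fin (n + 1) → ℝ) Q) r.domain ∧
        d = KZ.of r} :=
  fun c hc h0 => AddSubgroup.mem_sup_left (transcKernel x hx T hT c hc h0)

/-! ## §2 Instances: Lindemann and Chudnovsky read in the formal period ring -/

namespace Transc

/-- The values of the family `![⟦piRep⟧]`. [folklore] -/
theorem evalP_vecPi :
    (fun i : Fin 1 => KZ.evalP ((![KZ.toFormalPeriod (KZ.of KZ.piRep)] :
      Fin 1 → KZ.FormalPeriodRing) i)) = ![Real.pi] := by
  funext i
  fin_cases i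
  simp [KZ.piRep_value]

/-- **Lindemann in `P`**: the value of `⟦piRep⟧` is an algebraically independent singleton.
[cite: Lindemann1882] -/
theorem algebraicIndependent_vecPi :
    AlgebraicIndependent ℚ fun i : Fin 1 =>
      KZ.evalP ((![KZ.toFormalPeriod (KZ.of KZ.piRep)] : Fin 1 → KZ.FormalPeriodRing) i) := by
  rw [evalP_vecPi]
  exact algebraicIndependent_iff_transcendental.2 transcendental_pi_holds

/-- The values of the family `![⟦kRep⟧, ⟦piRep⟧]`. [folklore] -/
theorem evalP_vecKPi :
    (fun i : Fin 2 => KZ.evalP ((![KZ.toFormalPeriod (KZ.of kRep),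
      KZ.toFormalPeriod (KZ.of KZ.piRep)] : Fin 2 → KZ.FormalPeriodRing) i)) =
      ![lemniscaticK, Real.pi] := by
  funext i
  fin_cases i
  · simp [kRep_value]
  · simp [KZ.piRep_value]

/-- **Chudnovsky in `P`**: the values of `⟦kRep⟧`, `⟦piRep⟧` are algebraically independent.
[cite: Chudnovsky1984, Ch. 7 §2 Corollary 2.3] -/
theorem algebraicIndependent_vecKPi :
    AlgebraicIndependent ℚ fun i : Fin 2 =>
      KZ.evalP ((![KZ.toFormalPeriod (KZ.of kRep), KZ.toFormalPeriod (KZ.of KZ.piRep)] :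
        Fin 2 → KZ.FormalPeriodRing) i) := by
  rw [evalP_vecKPi]
  exact kPiAlgIndependent

/-- The values of the family `![⟦eRep⟧, ⟦piRep⟧]`. [folklore] -/
theorem evalP_vecEPi :
    (fun i : Fin 2 => KZ.evalP ((![KZ.toFormalPeriod (KZ.of eRep),
      KZ.toFormalPeriod (KZ.of KZ.piRep)] : Fin 2 → KZ.FormalPeriodRing) i)) =
      ![lemniscaticE, Real.pi] := by
  funext i
  fin_cases i
  · simp [eRep_value]
  · simp [KZ.piRep_value]

/-- **Chudnovsky in `P`, second pair**: the values of `⟦eRep⟧`, `⟦piRep⟧` are algebraically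
independent. [cite: Chudnovsky1984, Ch. 7 §2 Corollary 2.3] -/
theorem algebraicIndependent_vecEPi :
    AlgebraicIndependent ℚ fun i : Fin 2 =>
      KZ.evalP ((![KZ.toFormalPeriod (KZ.of eRep), KZ.toFormalPeriod (KZ.of KZ.piRep)] :
        Fin 2 → KZ.FormalPeriodRing) i) := by
  rw [evalP_vecEPi]
  exact ePiAlgIndependent

/-- The values of the family `![⟦kRep⟧, ⟦eRep⟧]`. [folklore] -/
theorem evalP_vecKE :
    (fun i : Fin 2 => KZ.evalP ((![KZ.toFormalPeriod (KZ.of kRep),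
      KZ.toFormalPeriod (KZ.of eRep)] : Fin 2 → KZ.FormalPeriodRing) i)) =
      ![lemniscaticK, lemniscaticE] := by
  funext i
  fin_cases i
  · simp [kRep_value]
  · simp [eRep_value]

/-- **Chudnovsky + Legendre in `P`**: the values of `⟦kRep⟧`, `⟦eRep⟧` are algebraically independent
(`keAlgIndependent_proof`, item stmt-KontsevichZagierPeriods-8611 of the Grothendieck route).
[cite: Chudnovsky1984, Ch. 7 §2 Corollary 2.3] -/
theorem algebraicIndependent_vecKE :
    AlgebraicIndependent ℚ fun i : Fin 2 =>
      KZ.evalP ((![KZ.toFormalPeriod (KZ.of kRep), KZ.toFormalPeriod (KZ.of eRep)] :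
        Fin 2 → KZ.FormalPeriodRing) i) := by
  rw [evalP_vecKE]
  exact Summit.KontsevichZagierPeriods.Grothendieck.keAlgIndependent_proof

/-- **`[ℝ, dx/(1+x²)]` has the class of the disc** (`PiNormalisation`, Kontsevich–Zagier's eq. (1)).
[cite: KontsevichZagier2001, §1.1 eq. (1)] -/
theorem toFormalPeriod_of_eq_piRep (p : KZ.IntegralRep 1) (hpd : p.domain = Set.univ)
    (hpi : p.integrand = fun x => 1 / (1 + x 0 ^ 2)) :
    KZ.toFormalPeriod (KZ.of p) = KZ.toFormalPeriod (KZ.of KZ.piRep) :=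
  KZ.Equivalent.toFormalPeriod_eq
    ((Summit.KontsevichZagierPeriods.CompiledSubstitutions.PiNormalisation.piNormalisation_proof
      KZ.piRep rfl (fun _ _ => rfl)).1 p hpd (fun x _ => by rw [hpi]))

/-- **The word classes of weights `2`, `4` are torsion generators over any subring containing `⟦piRep⟧`**
(`exists_nsmul_mem_of_wordClass` of the Grothendieck route, read through `[ℝ, dx/(1+x²)] ∼ disc`).
[cite: KontsevichZagier2001, §1.2] -/
theorem exists_nsmul_mem_of_wordClass_piRep (R₀ : Subring KZ.FormalPeriodRing)
    (hϖ : KZ.toFormalPeriod (KZ.of KZ.piRep) ∈ R₀) :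
    ∀ t ∈ KZ.toFormalPeriod '' (genSetAdm 2 ∪ genSetAdm 4), ∃ n : ℕ, n ≠ 0 ∧ n • t ∈ R₀ := by
  obtain ⟨p, hpd, hpi⟩ := Summit.KontsevichZagierPeriods.CobordismMove.CP2Volume.exists_cauchyRep₁
  have h := toFormalPeriod_of_eq_piRep p hpd hpi
  exact exists_nsmul_mem_of_wordClass p hpd hpi R₀ (h ▸ hϖ)

/-- Torsion generators over `K₀[x]` whenever `⟦piRep⟧` is one of the `x i`. [folklore] -/
theorem wordClass_torsion {ι : Type} (x : ι → KZ.FormalPeriodRing) (i₀ : ι)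
    (hi₀ : x i₀ = KZ.toFormalPeriod (KZ.of KZ.piRep)) :
    ∀ t ∈ KZ.toFormalPeriod '' (genSetAdm 2 ∪ genSetAdm 4), ∃ n : ℕ, n ≠ 0 ∧ n • t ∈ Subring.closure
        (Set.range (fun b : KZ.IntegralRep 0 => KZ.toFormalPeriod (KZ.of b)) ∪ Set.range x) :=
  exists_nsmul_mem_of_wordClass_piRep _ (Subring.subset_closure (Or.inr ⟨i₀, hi₀⟩))

end Transc

/-- **THE `ℚ̄`-π-ROOT RING THROUGH WEIGHT 4 — UNCONDITIONAL.** `evalP` is injective on the subring of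
the formal period ring generated by all dimension-zero classes (the real algebraic numbers), the disc
`⟦piRep⟧`, and the classes of the admissible MZV word representations of weights `2` and `4`: every
polynomial identity with real-algebraic coefficients among `π, ζ(2), ζ(4), ζ(3,1), ζ(2,2), ζ(2,1,1)` is
derivable by the moves (Lindemann + saturation). [cite: KontsevichZagier2001, §1.2] -/
theorem piSectorRingKernel :
    ∀ y ∈ Subring.closure
        (Set.range (fun b : KZ.IntegralRep 0 => KZ.toFormalPeriod (KZ.of b)) ∪
          Set.range (![KZ.toFormalPeriod (KZ.of KZ.piRep)] : Fin 1 → KZ.FormalPeriodRing) ∪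
          KZ.toFormalPeriod '' (genSetAdm 2 ∪ genSetAdm 4)),
      KZ.evalP y = 0 → y = 0 :=
  transcRingKernel_sat _ Transc.algebraicIndependent_vecPi _ (Transc.wordClass_torsion _ 0 rfl)

/-- **THE `ℚ̄[K(1/√2), π]`-ROOT RING THROUGH WEIGHT 4 — UNCONDITIONAL.** `evalP` is injective on the
subring generated by all dimension-zero classes, `⟦kRep⟧` (`K(1/√2)`), `⟦piRep⟧` and the admissible word
classes of weights `2`, `4`: every polynomial identity with real-algebraic coefficients among
`K(1/√2), π, ζ(2), ζ(4), ζ(3,1), ζ(2,2), ζ(2,1,1)` is derivable by the moves (Chudnovsky + saturation).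
[cite: Chudnovsky1984, Ch. 7 §2 Corollary 2.3] -/
theorem kPiSectorRingKernel :
    ∀ y ∈ Subring.closure
        (Set.range (fun b : KZ.IntegralRep 0 => KZ.toFormalPeriod (KZ.of b)) ∪
          Set.range (![KZ.toFormalPeriod (KZ.of kRep), KZ.toFormalPeriod (KZ.of KZ.piRep)] :
            Fin 2 → KZ.FormalPeriodRing) ∪
          KZ.toFormalPeriod '' (genSetAdm 2 ∪ genSetAdm 4)),
      KZ.evalP y = 0 → y = 0 :=
  transcRingKernel_sat _ Transc.algebraicIndependent_vecKPi _ (Transc.wordClass_torsion _ 1 rfl)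

/-- **THE `ℚ̄[E(1/√2), π]`-ROOT RING THROUGH WEIGHT 4 — UNCONDITIONAL** (second Chudnovsky pair).
[cite: Chudnovsky1984, Ch. 7 §2 Corollary 2.3] -/
theorem ePiSectorRingKernel :
    ∀ y ∈ Subring.closure
        (Set.range (fun b : KZ.IntegralRep 0 => KZ.toFormalPeriod (KZ.of b)) ∪
          Set.range (![KZ.toFormalPeriod (KZ.of eRep), KZ.toFormalPeriod (KZ.of KZ.piRep)] :
            Fin 2 → KZ.FormalPeriodRing) ∪
          KZ.toFormalPeriod '' (genSetAdm 2 ∪ genSetAdm 4)),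
      KZ.evalP y = 0 → y = 0 :=
  transcRingKernel_sat _ Transc.algebraicIndependent_vecEPi _ (Transc.wordClass_torsion _ 1 rfl)

/-- **THE RING `ℚ̄[K(1/√2), E(1/√2)]` — UNCONDITIONAL.** `evalP` is injective on the subring generated by
all dimension-zero classes and the classes `⟦kRep⟧`, `⟦eRep⟧` of the complete elliptic integrals at the
lemniscatic modulus: every polynomial identity with real-algebraic coefficients between `K(1/√2)` and
`E(1/√2)` is derivable by the moves (there is none: the pair is free). The VALUE `π = 4EK − 2K²` lies in
`ℚ(K, E)`, but the CLASS `⟦piRep⟧` is in this ring only given the Legendre transfer of the Grothendieck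
route, so no word classes are adjoined here. [cite: Chudnovsky1984, Ch. 7 §2 Corollary 2.3] -/
theorem kESectorRingKernel :
    ∀ y ∈ Subring.closure
        (Set.range (fun b : KZ.IntegralRep 0 => KZ.toFormalPeriod (KZ.of b)) ∪
          Set.range (![KZ.toFormalPeriod (KZ.of kRep), KZ.toFormalPeriod (KZ.of eRep)] :
            Fin 2 → KZ.FormalPeriodRing)),
      KZ.evalP y = 0 → y = 0 :=
  transcRingKernel _ Transc.algebraicIndependent_vecKE

/-- **Conjecture 1 (kernel form) on the `ℚ̄[K(1/√2), π]`-root ring, for formal combinations**: a formal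
`ℤ`-combination of representations whose class lies in that ring and whose value vanishes is a relation —
unconditionally. [cite: KontsevichZagier2001, §1.2] -/
theorem mem_relations_of_mem_kPiSector (c : KZ.FormalRep)
    (hc : KZ.toFormalPeriod c ∈ Subring.closure
        (Set.range (fun b : KZ.IntegralRep 0 => KZ.toFormalPeriod (KZ.of b)) ∪
          Set.range (![KZ.toFormalPeriod (KZ.of kRep), KZ.toFormalPeriod (KZ.of KZ.piRep)] :
            Fin 2 → KZ.FormalPeriodRing) ∪
          KZ.toFormalPeriod '' (genSetAdm 2 ∪ genSetAdm 4)))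
    (h0 : KZ.eval c = 0) : c ∈ KZ.relations :=
  transcKernel _ Transc.algebraicIndependent_vecKPi _ (Transc.wordClass_torsion _ 1 rfl) c hc h0

end Summit.KontsevichZagierPeriods.InverseLandau

end
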